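import Mathlib
import Summits.NavierStokesRegularity.NavierStokesRegularity.Theorems.FilamentSkeletonRssClause13LinearisedMapClauses
import Summits.NavierStokesRegularity.NavierStokesRegularity.Theorems.FilamentSkeletonRssClause13RRateColumnBall

/-!
# Clause 13-R: CLAMPING OF THE TEST FIELD AT THE EDGE OF THE TANGENCY BALL and the EDGE ROW
# (crux `Clause13RNearStraightL`, stmt-NavierStokesRegularity-23612; line `rate_bordered_split`, STUB R `stub_rateRow13RFlat`)

Route `FilamentSkeletonRss`, Variant A1R.  In STUB R the admissible variation `Y_j` is `C²` and vanishes OFF the tangency ball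
`{τ : ‖X_j τ‖ ≤ ℓ}`, `ℓ = R_b√(Γ log Γ)`, while the bordered defect `‖DT·Y − dα·R_j‖ ≤ L` is asked ON the ball.  This file isolates the
elementary structure at the BALL EDGE that every duality argument for the rate row has to use (memo of hand `leafhand-ns-filamentskeletonrs-16-g0`,
«edge measures»):

* §1 a `C²` function vanishing on an open set vanishes with its first two derivatives on the CLOSURE (`clamped_of_eqOn_open`);
* §2 the FIRST EXIT station `τ₊ > c` of a continuous curve from the ball: `‖X τ₊‖ = ℓ`, `‖X‖ ≤ ℓ` on `[c, τ₊]`, and `τ₊` is a limit of off-ball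
  stations (`exists_ballEdge`, `exists_ballEdge_of_tendsto` from the clause-3 escape `‖X_j τ‖ → ∞`);
* §3 hence `Y_j(τ₊) = Y_j′(τ₊) = Y_j″(τ₊) = 0` (`clamped_at_ballEdge`) and, by unit speed, `ℓ − ‖X c‖ ≤ τ₊ − c` (`edge_param_ge`);
* §4 at such a clamped in-ball station the closed form of `…Clause13LinearisedMapClauses.deriv_linearisedMap_inBall` loses ALL local terms: `DT·Y(τ₊)`
  is the normal projection of the pure Biot–Savart variation at the fixed point `X_j τ₊` (`deriv_linearisedMap_at_clamped`) — the «edge leak»;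
* §5 the EDGE ROW: `|dα|·‖R_j(τ₊)‖ ≤ L + ‖edge leak‖` with the near-straight floor
  `‖R_j(τ₊)‖ ≥ (ℓ − ‖X_j c‖)(√(θ₀(2−θ₀)) − 3R_b) − (1 + 2R_b)‖X_j c‖` (`…Clause13RRateColumnBall.rateColumn_norm_ge_nearStraight`), i.e. the rate row
  holds EXACTLY up to one linear functional of `Y` (the leak), which is what the edge atom of an annihilating measure pairs with.
Hand `leafhand-ns-filamentskeletonrs-16-g0` (LAND-ONLY); `--supports stmt-NavierStokesRegularity-23612` helper, def-free.  HONEST FRAMING: calculus at a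
HYPOTHETICAL filament skeleton on the NEGATIVE side of a MODEL blow-up route; STUB R is NOT proved here (the leak is not controlled by `L`) and nothing in
this file bears on Navier–Stokes regularity or blow-up.
-/

noncomputable section

open MeasureTheory Filter Topology Set Metric
open scoped InnerProductSpace
open Literature.Analysis.FluidPDE

namespace Summit.NavierStokesRegularity.NavierStokesRegularity.Theorems.Clause13REdgeClamping
set_option linter.dupNamespace false

/-! ## §1 Vanishing on an open set propagates to the closure, with two derivatives -/

/-- A function vanishing on an open set has vanishing derivative there. [folklore] -/
theorem deriv_eq_zero_of_eqOn_open {E : Type*} [NormedAddCommGroup E] [NormedSpace ℝ E] {f : ℝ → E} {U : Set ℝ}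
    (hU : IsOpen U) (hf : ∀ x ∈ U, f x = 0) : ∀ x ∈ U, deriv f x = 0 := by
  intro x hx
  have hev : f =ᶠ[𝓝 x] fun _ => (0 : E) :=
    Filter.eventually_of_mem (hU.mem_nhds hx) fun y hy => hf y hy
  rw [hev.deriv_eq, deriv_const]

/-- … and vanishing second derivative there. [folklore] -/
theorem iteratedDeriv_two_eq_zero_of_eqOn_open {E : Type*} [NormedAddCommGroup E] [NormedSpace ℝ E] {f : ℝ → E} {U : Set ℝ}
    (hU : IsOpen U) (hf : ∀ x ∈ U, f x = 0) : ∀ x ∈ U, iteratedDeriv 2 f x = 0 := by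
  intro x hx
  rw [iteratedDeriv_succ, iteratedDeriv_one]
  exact deriv_eq_zero_of_eqOn_open hU (deriv_eq_zero_of_eqOn_open hU hf) x hx

/-- A continuous function vanishing on a set vanishes on its closure. [folklore] -/
theorem eq_zero_of_mem_closure {E : Type*} [NormedAddCommGroup E] {f : ℝ → E} {U : Set ℝ} (hfc : Continuous f)
    (hf : ∀ x ∈ U, f x = 0) {x : ℝ} (hx : x ∈ closure U) : f x = 0 := by
  have hsub : U ⊆ f ⁻¹' {0} := fun y hy => hf y hy
  have hcl : closure U ⊆ f ⁻¹' {0} := closure_minimal hsub (isClosed_singleton.preimage hfc)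
  exact hcl hx

/-- **Clamping.**  A `C²` function vanishing on an open set `U` vanishes together with its first and second derivatives at every point of the
closure of `U`. [folklore] -/
theorem clamped_of_eqOn_open {E : Type*} [NormedAddCommGroup E] [NormedSpace ℝ E] {f : ℝ → E} {U : Set ℝ} (hf2 : ContDiff ℝ 2 f)
    (hU : IsOpen U) (hf : ∀ x ∈ U, f x = 0) {x : ℝ} (hx : x ∈ closure U) :
    f x = 0 ∧ deriv f x = 0 ∧ iteratedDeriv 2 f x = 0 := by
  refine ⟨eq_zero_of_mem_closure hf2.continuous hf hx, ?_, ?_⟩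
  · exact eq_zero_of_mem_closure (hf2.continuous_deriv (by norm_num)) (deriv_eq_zero_of_eqOn_open hU hf) hx
  · exact eq_zero_of_mem_closure (hf2.continuous_iteratedDeriv 2 (by norm_num)) (iteratedDeriv_two_eq_zero_of_eqOn_open hU hf) hx

/-! ## §2 The first exit station of a continuous curve from the ball `‖·‖ ≤ ℓ` -/

/-- **First exit station.**  A continuous curve starting inside the ball at parameter `c` (`‖X c‖ < ℓ`) and leaving it at some later parameter has a
first exit station `τ₊ > c`: `‖X τ₊‖ = ℓ`, `‖X τ‖ ≤ ℓ` on `[c, τ₊]`, and `τ₊` is a limit of off-ball stations. [folklore] -/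
theorem exists_ballEdge {E : Type*} [NormedAddCommGroup E] {X : ℝ → E} (hX : Continuous X) {c ℓ : ℝ} (hc : ‖X c‖ < ℓ)
    (hfar : ∃ τ₁, c ≤ τ₁ ∧ ℓ < ‖X τ₁‖) :
    ∃ τp, c < τp ∧ ‖X τp‖ = ℓ ∧ (∀ τ ∈ Icc c τp, ‖X τ‖ ≤ ℓ) ∧ τp ∈ closure {τ | ℓ < ‖X τ‖} := by
  set S : Set ℝ := {τ | c ≤ τ ∧ ℓ < ‖X τ‖} with hS
  obtain ⟨τ₁, hτ₁c, hτ₁ℓ⟩ := hfar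
  have hne : S.Nonempty := ⟨τ₁, hτ₁c, hτ₁ℓ⟩
  have hbdd : BddBelow S := ⟨c, fun τ hτ => hτ.1⟩
  set τp := sInf S with hτp
  have hcle : c ≤ τp := le_csInf hne fun τ hτ => hτ.1
  have hmemcl : τp ∈ closure S := csInf_mem_closure hne hbdd
  have hnormc : Continuous fun τ => ‖X τ‖ := hX.norm
  -- `ℓ ≤ ‖X τp‖`
  have hge : ℓ ≤ ‖X τp‖ := by
    have hclosed : IsClosed {τ | ℓ ≤ ‖X τ‖} := isClosed_le continuous_const hnormc
    have hsub : S ⊆ {τ | ℓ ≤ ‖X τ‖} := fun τ hτ => le_of_lt hτ.2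
    exact (closure_minimal hsub hclosed) hmemcl
  -- below `τp` (and after `c`) the curve is in the ball
  have hbelow : ∀ τ, c ≤ τ → τ < τp → ‖X τ‖ ≤ ℓ := by
    intro τ hcτ hlt
    by_contra h
    push Not at h
    have hmem : τ ∈ S := ⟨hcτ, h⟩
    have := csInf_le hbdd hmem
    linarith
  have hclt : c < τp := by
    rcases eq_or_lt_of_le hcle with h | h
    · exfalso; rw [← h] at hge; linarith
    · exact h
  -- `‖X τp‖ ≤ ℓ`
  have hle : ‖X τp‖ ≤ ℓ := by
    by_contra h
    push Not at h
    have hopen : IsOpen {τ | ℓ < ‖X τ‖} := isOpen_lt continuous_const hnormc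
    obtain ⟨δ, hδ, hball⟩ := Metric.isOpen_iff.1 hopen τp h
    set τ := max c (τp - δ / 2) with hτ
    have hτlt : τ < τp := max_lt hclt (by linarith)
    have hτc : c ≤ τ := le_max_left _ _
    have hτball : τ ∈ Metric.ball τp δ := by
      rw [Metric.mem_ball, Real.dist_eq, abs_lt]
      constructor
      · have : τp - δ / 2 ≤ τ := le_max_right _ _
        linarith
      · linarith
    have h1 : ℓ < ‖X τ‖ := hball hτball
    have h2 := hbelow τ hτc hτlt
    linarith
  refine ⟨τp, hclt, le_antisymm hle hge, fun τ hτ => ?_, closure_mono (fun τ hτ => hτ.2) hmemcl⟩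
  rcases eq_or_lt_of_le hτ.2 with h | h
  · rw [h]; exact hle
  · exact hbelow τ hτ.1 h

/-- The clause-3 escape `‖X τ‖ → ∞` (`Tendsto (‖X ·‖) (cocompact ℝ) atTop`) supplies the later off-ball station. [folklore] -/
theorem exists_ballEdge_of_tendsto {E : Type*} [NormedAddCommGroup E] {X : ℝ → E} (hX : Continuous X) {c ℓ : ℝ} (hc : ‖X c‖ < ℓ)
    (hT : Tendsto (fun τ => ‖X τ‖) (cocompact ℝ) atTop) :
    ∃ τp, c < τp ∧ ‖X τp‖ = ℓ ∧ (∀ τ ∈ Icc c τp, ‖X τ‖ ≤ ℓ) ∧ τp ∈ closure {τ | ℓ < ‖X τ‖} := by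
  have h1 : ∀ᶠ τ in atTop, ℓ < ‖X τ‖ := (hT.eventually (eventually_gt_atTop ℓ)).filter_mono atTop_le_cocompact
  obtain ⟨τ₁, hτ₁⟩ := (h1.and (eventually_ge_atTop c)).exists
  exact exists_ballEdge hX hc ⟨τ₁, hτ₁.2, hτ₁.1⟩

/-! ## §3 Clamping of the test field at the edge; the edge parameter is far from the waist -/

/-- **The test field is clamped at the ball edge.**  If `Y ∈ C²` vanishes wherever `ℓ < ‖X τ‖` (`X` continuous) then at every limit `τ₊` of
off-ball stations `Y(τ₊) = Y′(τ₊) = Y″(τ₊) = 0`. [folklore] -/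
theorem clamped_at_ballEdge {E F : Type*} [NormedAddCommGroup E] [NormedAddCommGroup F] [NormedSpace ℝ F] {X : ℝ → E} {Y : ℝ → F}
    (hX : Continuous X) (hY : ContDiff ℝ 2 Y) {ℓ : ℝ} (hYoff : ∀ τ, ℓ < ‖X τ‖ → Y τ = 0) {τp : ℝ}
    (hτp : τp ∈ closure {τ | ℓ < ‖X τ‖}) : Y τp = 0 ∧ deriv Y τp = 0 ∧ iteratedDeriv 2 Y τp = 0 :=
  clamped_of_eqOn_open hY (isOpen_lt continuous_const hX.norm) (fun τ hτ => hYoff τ hτ) hτp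

/-- **The edge parameter is at distance `≥ ℓ − ‖X c‖` from the waist parameter** (unit speed). [folklore] -/
theorem edge_param_ge {X : ℝ → EuclideanSpace ℝ (Fin 3)} (hX : Differentiable ℝ X) (hunit : ∀ σ, ‖deriv X σ‖ = 1) {c τp ℓ : ℝ}
    (hcτ : c ≤ τp) (hedge : ‖X τp‖ = ℓ) : ℓ - ‖X c‖ ≤ τp - c := by
  have h := Convex.norm_image_sub_le_of_norm_deriv_le (f := X) (C := 1) (fun r _ => hX r)
    (fun r _ => (hunit r).le) convex_univ (Set.mem_univ c) (Set.mem_univ τp)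
  rw [one_mul, Real.norm_eq_abs, abs_of_nonneg (sub_nonneg.2 hcτ)] at h
  have h2 : ‖X τp‖ ≤ ‖X c‖ + ‖X τp - X c‖ := by
    calc ‖X τp‖ = ‖X c + (X τp - X c)‖ := by rw [add_sub_cancel]
      _ ≤ ‖X c‖ + ‖X τp - X c‖ := norm_add_le _ _
  linarith

/-! ## §4 At a clamped in-ball station the linearised map is the pure Biot–Savart variation (the «edge leak») -/

/-- **The linearised map at a clamped in-ball station.**  Under the clause hypotheses of
`…Clause13LinearisedMapClauses.deriv_linearisedMap_inBall`, at an in-ball station `τ` of filament `j` where `Y_j τ = 0` and `Y_j′ τ = 0`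
(e.g. the first exit station of §2–§3) every LOCAL term of the closed form vanishes: `DT·Y(τ)` is the normal projection of the variation of the
regularised Biot–Savart velocity at the FIXED point `X_j τ` under `X_k ↦ X_k + sY_k` — a bounded linear functional of `Y` with no slip, strain,
rotation or `Y_j(τ)`-dependence (the «edge leak» paired by the edge atom of an annihilating measure). [folklore] -/
theorem deriv_linearisedMap_at_clamped {N : ℕ} {Γ α Rb Rw cg A₀ : ℝ} {γ : Fin N → ℝ}
    {X Y : Fin N → ℝ → EuclideanSpace ℝ (Fin 3)} {w : Fin N → ℝ → ℝ} {c : Fin N → ℝ} {Aa : Fin N → ℝ → ℝ}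
    {u : (Fin N → ℝ → EuclideanSpace ℝ (Fin 3)) → EuclideanSpace ℝ (Fin 3) → EuclideanSpace ℝ (Fin 3)}
    {v : EuclideanSpace ℝ (Fin 3) → EuclideanSpace ℝ (Fin 3)}
    {T : (Fin N → ℝ → EuclideanSpace ℝ (Fin 3)) → Fin N → ℝ → EuclideanSpace ℝ (Fin 3)}
    (hu : ∀ Z y, u Z y = ∑ k, (Γ * γ k / (4 * Real.pi)) • ∫ σ : ℝ,
      ((‖y - Z k σ‖ ^ 2 + Real.exp (-(1 + Real.eulerMascheroniConstant - Real.log 2)) * Aa k σ) ^ (3 / 2 : ℝ))⁻¹ •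
        cross (deriv (Z k) σ) (y - Z k σ))
    (hv : ∀ y, v y = u X y + (1 / 2 : ℝ) • y - α • cross (EuclideanSpace.single 2 1) y)
    (hT : ∀ Z j τ, T Z j τ = (u Z (Z j τ) + (1 / 2 : ℝ) • Z j τ - α • cross (EuclideanSpace.single 2 1) (Z j τ))
      - (⟪u Z (Z j τ) + (1 / 2 : ℝ) • Z j τ - α • cross (EuclideanSpace.single 2 1) (Z j τ), deriv (Z j) τ⟫_ℝ
          / ‖deriv (Z j) τ‖ ^ 2) • deriv (Z j) τ)
    (hX2 : ∀ k, ContDiff ℝ 2 (X k)) (hunit : ∀ k σ, ‖deriv (X k) σ‖ = 1)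
    (hcg : 0 < cg) (hcone : ∀ j τ, cg * |τ - c j| ≤ Rw * Real.sqrt Γ + ‖X j τ‖)
    (htan : ∀ j τ, ‖X j τ‖ ≤ Rb * Real.sqrt (Γ * Real.log Γ) → v (X j τ) = w j τ • deriv (X j) τ)
    (hAd : ∀ k, Differentiable ℝ (Aa k)) (hA₀ : 0 < A₀) (hAfl : ∀ k σ, A₀ ≤ Aa k σ)
    (hY2 : ∀ k, ContDiff ℝ 2 (Y k)) (hYoff : ∀ j τ, Rb * Real.sqrt (Γ * Real.log Γ) < ‖X j τ‖ → Y j τ = 0)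
    (j : Fin N) (τ : ℝ) (hin : ‖X j τ‖ ≤ Rb * Real.sqrt (Γ * Real.log Γ)) (hY0 : Y j τ = 0) (hY1 : deriv (Y j) τ = 0) :
    deriv (fun s : ℝ => T (fun k σ => X k σ + s • Y k σ) j τ) 0 =
      (∑ k, (Γ * γ k / (4 * Real.pi)) • ∫ σ : ℝ,
          ((-3 * ⟪X j τ - X k σ, -Y k σ⟫_ℝ *
              ((‖X j τ - X k σ‖ ^ 2 + Real.exp (-(1 + Real.eulerMascheroniConstant - Real.log 2)) * Aa k σ) ^ (5 / 2 : ℝ))⁻¹) •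
            cross (deriv (X k) σ) (X j τ - X k σ) +
          ((‖X j τ - X k σ‖ ^ 2 + Real.exp (-(1 + Real.eulerMascheroniConstant - Real.log 2)) * Aa k σ) ^ (3 / 2 : ℝ))⁻¹ •
            (cross (deriv (X k) σ) (-Y k σ) + cross (deriv (Y k) σ) (X j τ - X k σ))))
       - ⟪(∑ k, (Γ * γ k / (4 * Real.pi)) • ∫ σ : ℝ,
          ((-3 * ⟪X j τ - X k σ, -Y k σ⟫_ℝ *
              ((‖X j τ - X k σ‖ ^ 2 + Real.exp (-(1 + Real.eulerMascheroniConstant - Real.log 2)) * Aa k σ) ^ (5 / 2 : ℝ))⁻¹) •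
            cross (deriv (X k) σ) (X j τ - X k σ) +
          ((‖X j τ - X k σ‖ ^ 2 + Real.exp (-(1 + Real.eulerMascheroniConstant - Real.log 2)) * Aa k σ) ^ (3 / 2 : ℝ))⁻¹ •
            (cross (deriv (X k) σ) (-Y k σ) + cross (deriv (Y k) σ) (X j τ - X k σ)))), deriv (X j) τ⟫_ℝ • deriv (X j) τ := by
  -- `e₃ × 0 = 0` (the landed `Iotti2025.cross_zero_right`, re-derived inline to keep the imports route-local)
  have hc0 : ∀ a : EuclideanSpace ℝ (Fin 3), cross a 0 = 0 := fun a => by rw [← crossCLM_apply, map_zero]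
  rw [Clause13LinearisedMapClauses.deriv_linearisedMap_inBall hu hv hT hX2 hunit hcg hcone htan hAd hA₀ hAfl hY2 hYoff j τ hin,
    hY0, hY1]
  simp only [zero_sub, smul_zero, inner_zero_right, mul_zero, zero_smul, sub_zero, add_zero, hc0]

/-! ## §5 The edge row: the rate row holds exactly up to the edge leak -/

/-- **Bordered triangle at one station**: `‖D − dα·R‖ ≤ L` gives `|dα|·‖R‖ ≤ L + ‖D‖`. [folklore] -/
theorem rate_le_of_bordered {D R : EuclideanSpace ℝ (Fin 3)} {dα L : ℝ} (h : ‖D - dα • R‖ ≤ L) : |dα| * ‖R‖ ≤ L + ‖D‖ := by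
  have : ‖dα • R‖ ≤ ‖D - dα • R‖ + ‖D‖ := by
    calc ‖dα • R‖ = ‖D - (D - dα • R)‖ := by rw [sub_sub_cancel]
      _ ≤ ‖D‖ + ‖D - dα • R‖ := norm_sub_le _ _
      _ = ‖D - dα • R‖ + ‖D‖ := add_comm _ _
  rw [norm_smul, Real.norm_eq_abs] at this
  linarith

/-- **THE EDGE ROW.**  For a unit-speed `C¹` curve, near-straight to tolerance `R_b` (`‖X′τ − X′σ‖ ≤ R_b`) and tilted at the waist parameter `c`
(`|⟪X′c, e₃⟫| ≤ 1 − θ₀`), at any station `τ₊ ≥ c` ON THE SPHERE `‖X τ₊‖ = ℓ` where the bordered defect is `‖D − dα·R(τ₊)‖ ≤ L`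
(`R = e₃ × X − ⟪e₃ × X, X′⟫X′` the rate column, `D` the value of the linearised map there — at a clamped station the pure edge leak of §4):
`|dα|·((ℓ − ‖X c‖)(√(θ₀(2−θ₀)) − 3R_b) − (1 + 2R_b)‖X c‖) ≤ L + ‖D‖`. [folklore] -/
theorem edgeRow {X : ℝ → EuclideanSpace ℝ (Fin 3)} {Rb θ₀ : ℝ} (hX : Differentiable ℝ X) (hunit : ∀ σ, ‖deriv X σ‖ = 1)
    (hns : ∀ τ σ, ‖deriv X τ - deriv X σ‖ ≤ Rb) (c : ℝ) (htilt : |⟪deriv X c, EuclideanSpace.single 2 (1:ℝ)⟫_ℝ| ≤ 1 - θ₀)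
    (hRb3 : 3 * Rb ≤ Real.sqrt (θ₀ * (2 - θ₀))) {τp ℓ : ℝ} (hcτ : c ≤ τp) (hedge : ‖X τp‖ = ℓ)
    {D : EuclideanSpace ℝ (Fin 3)} {dα L : ℝ}
    (hdef : ‖D - dα • (cross (EuclideanSpace.single 2 (1:ℝ)) (X τp)
      - ⟪cross (EuclideanSpace.single 2 (1:ℝ)) (X τp), deriv X τp⟫_ℝ • deriv X τp)‖ ≤ L) :
    |dα| * ((ℓ - ‖X c‖) * (Real.sqrt (θ₀ * (2 - θ₀)) - 3 * Rb) - (1 + 2 * Rb) * ‖X c‖) ≤ L + ‖D‖ := by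
  have hfloor := Clause13RRateRow.rateColumn_norm_ge_nearStraight hX hunit hns c htilt τp
  have hpar := edge_param_ge hX hunit hcτ hedge
  have habs : ℓ - ‖X c‖ ≤ |τp - c| := le_trans hpar (le_abs_self _)
  have hstep : (ℓ - ‖X c‖) * (Real.sqrt (θ₀ * (2 - θ₀)) - 3 * Rb) ≤ |τp - c| * (Real.sqrt (θ₀ * (2 - θ₀)) - 3 * Rb) :=
    mul_le_mul_of_nonneg_right habs (by linarith)
  have hR : (ℓ - ‖X c‖) * (Real.sqrt (θ₀ * (2 - θ₀)) - 3 * Rb) - (1 + 2 * Rb) * ‖X c‖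
      ≤ ‖cross (EuclideanSpace.single 2 (1:ℝ)) (X τp) - ⟪cross (EuclideanSpace.single 2 (1:ℝ)) (X τp), deriv X τp⟫_ℝ • deriv X τp‖ := by
    linarith
  have hrate := rate_le_of_bordered hdef
  calc |dα| * ((ℓ - ‖X c‖) * (Real.sqrt (θ₀ * (2 - θ₀)) - 3 * Rb) - (1 + 2 * Rb) * ‖X c‖)
      ≤ |dα| * ‖cross (EuclideanSpace.single 2 (1:ℝ)) (X τp) - ⟪cross (EuclideanSpace.single 2 (1:ℝ)) (X τp), deriv X τp⟫_ℝ • deriv X τp‖ :=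
        mul_le_mul_of_nonneg_left hR (abs_nonneg _)
    _ ≤ L + ‖D‖ := hrate

end Summit.NavierStokesRegularity.NavierStokesRegularity.Theorems.Clause13REdgeClamping

end
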